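import Literature.AlgebraicGeometry.Frobenioids.FrobenioidNatIso
import Literature.AlgebraicGeometry.Frobenioids.PreFrobenioidPullbacks
import HarnessLib

/-!
# Frobenioids I: a structure isomorphic to a Frobenioid is a Frobenioid

Mochizuki, *The geometry of Frobenioids I: the general theory*, Kyushu J. Math. **62** (2008)
293–400, §1, Definition 1.3 (Frobenioids), kurims pp. 24–27 [cite: MochizukiFrdI2008, Def. 1.3 p.24].

For an isomorphism `e : F ≅ F'` of structure functors `C → F_Φ` ("1-commutativity", FrdI §0 p. 15),
the conditions (i)–(vii) of Def. 1.3 pass from `F` to `F'` (`IsFrobenioid.of_natIso`): every notion of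
Def. 1.2 is the same for `F` and `F'` (`FrobenioidNatIso.lean`), the clauses mentioning `Base`, `Div`,
`(ψ^*)⁻¹ Div` explicitly are conjugated by the base isomorphisms `b_A = Base(e_A)` (`Div_{F'} =
(b⁻¹)^* Div_F`), `O^▷`, `O^×` coincide, and (i)(c) uses that `C^pl-bk_A → D_{A_D}` is already full and
faithful in any pre-Frobenioid (abc-iut-found, `PreFrobenioidPullbacks.lean`) so that only essential
surjectivity is transported — the same scheme as `IsFrobenioid.comp_equivalence`
(`FrobenioidEquivalence.lean`, abc-iut-L6-t6) for equivalences of the underlying category.  Tooling for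
GAP row G-L6t9-1 (sub-DAG W7, row P25-L09 `FrdI.P25.CdFrobenioid`); no new definitions; no statement of
the paper is strengthened.
-/

namespace Literature.AlgebraicGeometry.Frobenioids

open CategoryTheory Opposite

universe w v v' u u'

namespace PreFrobenioid

variable {D : Type u} [Category.{v} D] {Φ : Dᵒᵖ ⥤ CommMonCat.{w}}
  {C : Type u'} [Category.{v'} C] {F F' : C ⥤ ElemFrobenioid Φ} (e : F ≅ F')

include e

open StructureIso

/-! ### Definition 1.3 (i)(c) under an isomorphism of structures -/

/-- For a Frobenioid `F` and `e : F ≅ F'`, the functor `C^pl-bk_A → D_{A'_D}` of `F'` is essentially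
surjective: an object `X → A'_D` over `A'_D := Base_{F'}(A)` is moved to `X → A_D` by `b_A⁻¹`, realised
by a pull-back morphism `ψ : B → A` of `F` (Def. 1.3 (i)(c) for `F`) — a pull-back morphism of `F'` as
well — and `Base_{F'}(ψ) = b_B⁻¹ ∘ Base_F(ψ) ∘ b_A` lies over the given object.
[cite: MochizukiFrdI2008, Def. 1.3(i) p.24] -/
theorem pullbackSliceToBase_essSurj_of_natIso (hF : IsFrobenioid F) (A : C) :
    (pullbackSliceToBase F' A).EssSurj := by
  haveI := hF.i_c A
  refine ⟨fun d => ?_⟩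
  -- move `d` to an object over `Base_F(A)` and realise it by a pull-back morphism of `F`
  let dh : d.left ⟶ baseObj F' A := d.hom
  let d₀ : Over (baseObj F A) := Over.mk (dh ≫ ElemFrobenioid.Base (e.inv.app A))
  let Y := (pullbackSliceToBase F A).objPreimage d₀
  let iY : (pullbackSliceToBase F A).obj Y ≅ d₀ := (pullbackSliceToBase F A).objObjPreimageIso d₀
  let B : C := Y.left.obj
  let ψ : B ⟶ A := Y.hom.1
  have hψ : IsPullbackMorphism F ψ := Y.hom.2
  have hψ' : IsPullbackMorphism F' ψ := (isPullbackMorphism_iff e ψ).mpr hψ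
  let Y' : Over (⟨A⟩ : PullbackCat F') := Over.mk (Y := (⟨B⟩ : PullbackCat F')) ⟨ψ, hψ'⟩
  refine ⟨Y', ⟨?_⟩⟩
  have hw : iY.hom.left ≫ (dh ≫ ElemFrobenioid.Base (e.inv.app A)) = Base F ψ := Over.w iY.hom
  have hw' : iY.hom.left ≫ dh = Base F ψ ≫ ElemFrobenioid.Base (e.hom.app A) := by
    have h2 := congrArg (fun t => t ≫ ElemFrobenioid.Base (e.hom.app A)) hw
    simp only [Category.assoc, base_inv_hom_app e, Category.comp_id] at h2
    exact h2
  refine Over.isoMk (((ElemFrobenioid.baseFunctor Φ).mapIso (e.app B)).symm ≪≫ (Over.forget _).mapIso iY) ?_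
  show (ElemFrobenioid.Base (e.app B).inv ≫ iY.hom.left) ≫ dh = Base F' ψ
  rw [base_eq e ψ, Category.assoc]
  exact congrArg (fun t => ElemFrobenioid.Base (e.inv.app B) ≫ t) hw'

/-- For a Frobenioid `F` and `e : F ≅ F'`, `C^pl-bk_A → D_{A'_D}` is an equivalence for `F'`
(Def. 1.3 (i)(c)). [cite: MochizukiFrdI2008, Def. 1.3(i) p.24] -/
theorem isEquivalence_pullbackSliceToBase_of_natIso (hF : IsFrobenioid F) (A : C) :
    (pullbackSliceToBase F' A).IsEquivalence :=
  haveI := pullbackSliceToBase_faithful F' A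
  haveI := pullbackSliceToBase_full F' A
  haveI := pullbackSliceToBase_essSurj_of_natIso e hF A
  { }

/-! ### Definition 1.3 under an isomorphism of structures -/

/-- **A structure `C → F_Φ` isomorphic to a Frobenioid is a Frobenioid**: for `e : F ≅ F'` and a
Frobenioid `F`, the functor `F'` is a Frobenioid (all of Definition 1.3 (i)–(vii), clause by clause).
[cite: MochizukiFrdI2008, Def. 1.3 p.24] -/
theorem IsFrobenioid.of_natIso (hF : IsFrobenioid F) : IsFrobenioid F' := by
  have hP : IsPreFrobenioid Φ F := hF.isPreFrobenioid
  have hΦ : ∀ A : D, IsSharp (Φ.obj (op A)) := fun A => (hP.isDivisorial A).isSharp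
  refine
    { isPreFrobenioid := IsPreFrobenioid.of_natIso e hP
      i_a := ?_, i_b := ?_, i_c := isEquivalence_pullbackSliceToBase_of_natIso e hF
      ii_exists := ?_, ii_unique := ?_
      iii_a := ?_, iii_b := ?_, iii_c := ?_, iii_c_base := ?_
      iii_d_under_full := ?_, iii_d_under_surj := ?_, iii_d_over_full := ?_, iii_d_over_surj := ?_
      iv_a_exists := ?_, iv_a_unique := ?_, iv_b := ?_
      v_a := ?_, v_b_exists := ?_, v_b_unique := ?_, v_c_exists := ?_, v_c_unique := ?_
      vi := ?_, vii_a := ?_, vii_b := ?_ }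
  -- (i)(a)
  · intro A₀
    obtain ⟨A, hA, ⟨i⟩⟩ := hF.i_a A₀
    exact ⟨A, (isFrobeniusTrivial_iff e hΦ A).mpr hA,
      ⟨((ElemFrobenioid.baseFunctor Φ).mapIso (e.app A)).symm ≪≫ i⟩⟩
  -- (i)(b)
  · intro A B α
    obtain ⟨X, φ, ψ, hφ, hψ, h⟩ := hF.i_b A B
      ((ElemFrobenioid.baseFunctor Φ).mapIso (e.app A) ≪≫ α ≪≫
        ((ElemFrobenioid.baseFunctor Φ).mapIso (e.app B)).symm)
    refine ⟨X, φ, ψ, (isPreStep_iff e φ).mpr hφ, (isPreStep_iff e ψ).mpr hψ, ?_⟩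
    have h' : Base F φ ≫ ElemFrobenioid.Base (e.hom.app A) ≫ α.hom ≫ ElemFrobenioid.Base (e.inv.app B) =
        Base F ψ := h
    rw [base_eq e, base_eq e, ← h']
    simp only [Category.assoc, base_inv_hom_app e, Category.comp_id]
  -- (ii) existence
  · intro A n
    obtain ⟨B, φ, hφ, hn⟩ := hF.ii_exists A n
    exact ⟨B, φ, (isFrobeniusType_iff e hΦ φ).mpr hφ, (degFr_eq e φ).trans hn⟩
  -- (ii) uniqueness
  · intro A B B' φ ψ hφ hψ hn
    rw [degFr_eq e, degFr_eq e] at hn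
    exact hF.ii_unique φ ψ ((isFrobeniusType_iff e hΦ φ).mp hφ) ((isFrobeniusType_iff e hΦ ψ).mp hψ) hn
  -- (iii)(a)
  · intro X Y Z f g hf hg
    exact (isCoAngular_iff e hΦ _).mpr
      (hF.iii_a f g ((isCoAngular_iff e hΦ f).mp hf) ((isCoAngular_iff e hΦ g).mp hg))
  -- (iii)(b)
  · intro A' A φ hφ ψ
    exact (isCoAngular_iff e hΦ ψ).mpr (hF.iii_b φ ((isCoAngularPreStep_iff e hΦ φ).mp hφ) ψ)
  -- (iii)(c)
  · intro A B φ hφ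
    obtain ⟨E, hE⟩ := hF.iii_c φ ((isCoAngularPreStep_iff e hΦ φ).mp hφ)
    refine ⟨(MulEquiv.submonoidCongr (endSubmonoid_eq e A)).trans
      (E.trans (MulEquiv.submonoidCongr (endSubmonoid_eq e B)).symm), fun α => ?_⟩
    exact hE ⟨α.1, (endSubmonoid_eq e A) ▸ α.2⟩
  -- (iii)(c), dependence on Base only
  · intro A B φ φ' hφ hφ' hb α β β' h1 h2
    have key := hF.iii_c_base φ φ' ((isCoAngularPreStep_iff e hΦ φ).mp hφ)
      ((isCoAngularPreStep_iff e hΦ φ').mp hφ') ((base_eq_base_iff e φ φ').mp hb)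
      ⟨α.1, (endSubmonoid_eq e A) ▸ α.2⟩ ⟨β.1, (endSubmonoid_eq e B) ▸ β.2⟩
      ⟨β'.1, (endSubmonoid_eq e B) ▸ β'.2⟩ h1 h2
    have hv := congrArg Subtype.val key
    exact Subtype.ext hv
  -- (iii)(d) coslice, full
  · intro A B B' φ φ' hφ hφ' hd
    obtain ⟨f, hf, hff⟩ := hF.iii_d_under_full φ φ' ((isCoAngularPreStep_iff e hΦ φ).mp hφ)
      ((isCoAngularPreStep_iff e hΦ φ').mp hφ') ((div_dvd_iff e hΦ φ φ').mp hd)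
    exact ⟨f, (isCoAngularPreStep_iff e hΦ f).mpr hf, hff⟩
  -- (iii)(d) coslice, essentially surjective
  · intro A x
    obtain ⟨B, φ, hφ, hdiv⟩ :=
      hF.iii_d_under_surj A (pull Φ (ElemFrobenioid.Base (e.hom.app A)) x)
    refine ⟨B, φ, (isCoAngularPreStep_iff e hΦ φ).mpr hφ, ?_⟩
    rw [div_eq e hΦ, hdiv, pull_inv_pull_hom e]
  -- (iii)(d) slice, full
  · intro A B B' ψ ψ' h h' hd
    have h₀ := (isCoAngularPreStep_iff e hΦ ψ).mp h
    have h₀' := (isCoAngularPreStep_iff e hΦ ψ').mp h'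
    obtain ⟨g, hg, hgg⟩ := hF.iii_d_over_full ψ ψ' h₀ h₀'
      ((invDiv_dvd_iff e hΦ ψ ψ' h₀.2.2 h.2.2 h₀'.2.2 h'.2.2).mp hd)
    exact ⟨g, (isCoAngularPreStep_iff e hΦ g).mpr hg, hgg⟩
  -- (iii)(d) slice, essentially surjective
  · intro A x
    obtain ⟨B, ψ, h, hx⟩ :=
      hF.iii_d_over_surj A (pull Φ (ElemFrobenioid.Base (e.hom.app A)) x)
    refine ⟨B, ψ, (isCoAngularPreStep_iff e hΦ ψ).mpr h, ?_⟩
    rw [invDiv_eq e hΦ ψ h.2.2, hx, pull_inv_pull_hom e]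
  -- (iv)(a) existence
  · intro A B φ
    obtain ⟨X, Y, γ, β, α, hfac, hγ, hβ, hα⟩ := hF.iv_a_exists φ
    exact ⟨X, Y, γ, β, α, hfac, (isFrobeniusType_iff e hΦ γ).mpr hγ, (isPreStep_iff e β).mpr hβ,
      (isPullbackMorphism_iff e α).mpr hα⟩
  -- (iv)(a) uniqueness
  · intro A B X Y X' Y' φ γ β α γ' β' α' h1 hγ hβ hα h2 hγ' hβ' hα'
    exact hF.iv_a_unique φ γ β α γ' β' α' h1 ((isFrobeniusType_iff e hΦ γ).mp hγ)
      ((isPreStep_iff e β).mp hβ) ((isPullbackMorphism_iff e α).mp hα) h2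
      ((isFrobeniusType_iff e hΦ γ').mp hγ') ((isPreStep_iff e β').mp hβ')
      ((isPullbackMorphism_iff e α').mp hα')
  -- (iv)(b)
  · intro A B φ hφ
    obtain ⟨h1, h2⟩ := hF.iv_b φ ((isPullbackMorphism_iff e φ).mp hφ)
    exact ⟨(isLBInvertible_iff e hΦ φ).mpr h1, (isLinear_iff e φ).mpr h2⟩
  -- (v)(a)
  · intro A B φ hφ
    exact hF.v_a φ ((isPreStep_iff e φ).mp hφ)
  -- (v)(b) existence
  · intro A B φ hφ
    obtain ⟨X, β, α, hfac, hβ, hα⟩ := hF.v_b_exists φ ((isPreStep_iff e φ).mp hφ)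
    exact ⟨X, β, α, hfac, (isCoAngularPreStep_iff e hΦ β).mpr hβ,
      ⟨(isIsometry_iff e hΦ α).mpr hα.1, (isPreStep_iff e α).mpr hα.2⟩⟩
  -- (v)(b) uniqueness
  · intro A B X X' φ β α β' α' h1 hβ hα h2 hβ' hα'
    exact hF.v_b_unique φ β α β' α' h1 ((isCoAngularPreStep_iff e hΦ β).mp hβ)
      ⟨(isIsometry_iff e hΦ α).mp hα.1, (isPreStep_iff e α).mp hα.2⟩ h2
      ((isCoAngularPreStep_iff e hΦ β').mp hβ')
      ⟨(isIsometry_iff e hΦ α').mp hα'.1, (isPreStep_iff e α').mp hα'.2⟩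
  -- (v)(c) existence
  · intro A B φ hφ
    obtain ⟨X, β', α', hfac, hβ', hα'⟩ := hF.v_c_exists φ ((isPreStep_iff e φ).mp hφ)
    exact ⟨X, β', α', hfac, ⟨(isIsometry_iff e hΦ β').mpr hβ'.1, (isPreStep_iff e β').mpr hβ'.2⟩,
      (isCoAngularPreStep_iff e hΦ α').mpr hα'⟩
  -- (v)(c) uniqueness
  · intro A B X X' φ β α β' α' h1 hβ hα h2 hβ' hα'
    exact hF.v_c_unique φ β α β' α' h1
      ⟨(isIsometry_iff e hΦ β).mp hβ.1, (isPreStep_iff e β).mp hβ.2⟩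
      ((isCoAngularPreStep_iff e hΦ α).mp hα) h2
      ⟨(isIsometry_iff e hΦ β').mp hβ'.1, (isPreStep_iff e β').mp hβ'.2⟩
      ((isCoAngularPreStep_iff e hΦ α').mp hα')
  -- (vi)
  · intro A B φ ψ hφ hψ hb hm
    obtain ⟨α, hα, h⟩ := hF.vi φ ψ ((isCoAngularPreStep_iff e hΦ φ).mp hφ)
      ((isCoAngularPreStep_iff e hΦ ψ).mp hψ) ((baseEquivalent_iff e φ ψ).mp hb)
      ((metricallyEquivalent_iff e hΦ φ ψ).mp hm)
    refine ⟨α, ?_, h⟩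
    rw [unitsSubgroup_eq e]
    exact hα
  -- (vii)(a)
  · intro A
    obtain ⟨B, φ, hφ⟩ := hF.vii_a A
    exact ⟨B, φ, (isIsotropicHull_iff e hΦ φ).mpr hφ⟩
  -- (vii)(b)
  · intro A B φ hA
    exact (isIsotropic_iff e hΦ B).mpr (hF.vii_b φ ((isIsotropic_iff e hΦ A).mp hA))

/-- The symmetric form: `F` is a Frobenioid iff `F'` is. [cite: MochizukiFrdI2008, Def. 1.3 p.24] -/
theorem isFrobenioid_iff_of_natIso : IsFrobenioid F ↔ IsFrobenioid F' :=
  ⟨IsFrobenioid.of_natIso e, IsFrobenioid.of_natIso e.symm⟩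

end PreFrobenioid

end Literature.AlgebraicGeometry.Frobenioids
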